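import Summits.BirchSwinnertonDyer.BirchSwinnertonDyer.Theorems.QuadraticBranchSignedControlPlusEtaNonsurjBDMTVPrimes
import Summits.BirchSwinnertonDyer.Rank1Residual.Partition.MainConjecturesCMInert
import HarnessLib

/-!
# Route `QuadraticBranchSignedControl` (rung K8, cell `bsd-potss`): crux stmt-BirchSwinnertonDyer-19606
# `PlusEtaMainConjectureNonsurj` — ROWS AT THE BDMTV PRIMES, BOTH DIRECTIONS: a globally minimal curve good at `13` (resp. `17`)
# IS a row of the crux (`a_p = 0`, tower not onto) IFF its `j`-invariant is one of SEVEN values (⟹ BDMTV; ⟸ Deuring + Zywina, kernel)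

WHAT. `…PlusEtaNonsurjBDMTVPrimes` (k8eta-c2 g17, p649362) proved «⟹»: GIVEN the BDMTV CM-ness theorem, a row at `13` / `17` has `j` in
an explicit seven-element CM set. This file proves «⟸» with NO named fact and for EVERY curve (not only the reference rows of
`…BDMTVPrimesRows`): if `V/ℚ` is globally minimal, good at `13` (resp. `17`) and `j(V)` is in the set, then `V` has CM with `13` (resp. `17`)
INERT in the CM field (the table `cmFieldDiscrOfJ` + quadratic non-residues, `decide`), hence `a_p(V) = 0` by DEURING — the tree THEOREM
`Rank1Residual.frobeniusTrace_eq_zero_of_hasCM_of_cmInert` (CM + odd good inert prime ⟹ `a_p = 0`, every CM order; Lang Ch. 13 §4 Thm. 12,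
discharged in the tree) — and the `p`-adic tower is not onto (Zywina, `not_hasSurjectiveModNGaloisRep_of_hasCM`). So:

* §1 `hasCM_cmInert_thirteen_of_j_mem` / `_seventeen` (kernel): `j ∈ S₁₃ ⟹ CM ∧ CMInert V 13`, `j ∈ S₁₇ ⟹ CM ∧ CMInert V 17`.
* §2 `row_thirteen_of_j_mem` / `row_seventeen_of_j_mem` (kernel, no named fact): good at `p` and `j ∈ S_p` ⟹ `a_p = 0`, tower not onto, CM.
* §3 `row_thirteen_iff_j_mem (h13)` / `row_seventeen_iff_j_mem (h17)`: **for `V` globally minimal and good at `13` (resp. `17`):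
  `(a_p(V) = 0 ∧ ¬ ∀ m, ρ_{V,p^m} onto) ⟺ j(V) ∈ S_p`** — the rows of crux 19606 at the BDMTV primes are EXACTLY the globally minimal curves
  good at `p` with `j` in the seven-element set (`S₁₃`: discriminants `−7, −28, −8, −11, −19, −67, −163`; `S₁₇`: `−3, −12, −27, −7, −28, −11, −163`,
  matching BDMTV 2019 Cor. 1.3 / 2023 Thm. 1.2).
* §4 `plusEtaAt_thirteen_iff_jClasses (h13)` / `plusEtaAt_seventeen_iff_jClasses (h17)`: the crux's content at `p ∈ {13, 17}` restated —
  (C1⁺_η) on the rows at `p` ⟺ (C1⁺_η) on the globally minimal curves good at `p` with `j ∈ S_p` (node in hypothesis / conclusion positions only).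

HONEST FRAMING (cell `bsd-potss`, run/shared/lean/pub/bsd-potss/; FULL-BSD rank ≤ 1 programme): bookkeeping / structure theorems; no
definition, no new named fact, no `sorry`, axioms standard; §1–§2 unconditional, §3–§4 conditional on the displayed BDMTV facts (typed in the tree).
Nothing about (C1⁺_η) is proved; crux 19606 stays OPEN; `BSD(W, p)` is claimed for no pair. Seat `bsd-potss-k8eta-c2` g17 (prover),
`--supports stmt-BirchSwinnertonDyer-19606`.

References: [BalakrishnanEtAl2019] Cor. 1.3; [BalakrishnanEtAl2023] Thm. 1.2; [Lang1987] Ch. 13 §4 Thm. 12 (Deuring); [Cox2013] Prop. 5.16 /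
Cor. 5.17; [SilvermanAdvancedTopics1994] App. A §3; [Zywina2015] Prop. 1.14; [Serre1972] §1.11 Prop. 12, §2.7 Prop. 17; [Kobayashi2003] §4 (p. 8).
-/

set_option autoImplicit false
set_option linter.dupNamespace false

noncomputable section

open scoped Classical

open WeierstrassCurve Literature.NumberTheory.EllipticCurves Literature.NumberTheory.EllipticCurves.Rank1Residual
  Literature.NumberTheory.SerreUniformity Summit.BirchSwinnertonDyer.Rank1Residual.Additive

namespace Summit.BirchSwinnertonDyer.BirchSwinnertonDyer.Theorems.EtaBDMTVPrimes

open Summit.BirchSwinnertonDyer.BirchSwinnertonDyer.Theorems.EtaCartanField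

/-! ## §1 `j` in the seven-element set ⟹ CM with `p` inert (kernel tables) -/

/-- **`j ∈ S₁₃ ⟹ CM with `13` inert.** For an elliptic `V/ℚ` with `j(V) ∈ {−3375, 16581375, 8000, −32768, −884736, −147197952000,
−262537412640768000}`: `V` has CM (`hasCM_iff_j_mem_holds`) and `CMInert V 13` (`d_K ∈ {−7, −8, −11, −19, −67, −163}`, `13 ∤ d_K`,
`d_K` a non-residue mod `13` — `decide`). [cite: SilvermanAdvancedTopics1994, App. A §3] [cite: Cox2013, Prop. 5.16 and Cor. 5.17] -/
theorem hasCM_cmInert_thirteen_of_j_mem (V : WeierstrassCurve ℚ) [V.IsElliptic] (hj : V.j ∈ ({-3375, 16581375, 8000, -32768, -884736, -147197952000, -262537412640768000} : Finset ℚ)) :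
    V.HasCM ∧ CMInert V 13 := by
  have hCM : V.HasCM := (hasCM_iff_j_mem_holds V).mpr (by
    simp only [Finset.mem_insert, Finset.mem_singleton] at hj
    rcases hj with h | h | h | h | h | h | h <;> rw [h] <;> simp [cmJInvariants])
  unfold CMInert
  simp only [Finset.mem_insert, Finset.mem_singleton] at hj
  rcases hj with h | h | h | h | h | h | h
  · have hd : cmFieldDiscrOfJ V.j = -7 := by rw [h]; norm_num [cmFieldDiscrOfJ]
    refine ⟨hCM, ?_, ?_⟩
    · unfold CMRamified; rw [hd]; decide
    · unfold CMSplit; rw [hd, if_neg (by decide)]; rintro ⟨-, r, hr⟩; revert r hr; decide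
  · have hd : cmFieldDiscrOfJ V.j = -7 := by rw [h]; norm_num [cmFieldDiscrOfJ]
    refine ⟨hCM, ?_, ?_⟩
    · unfold CMRamified; rw [hd]; decide
    · unfold CMSplit; rw [hd, if_neg (by decide)]; rintro ⟨-, r, hr⟩; revert r hr; decide
  · have hd : cmFieldDiscrOfJ V.j = -8 := by rw [h]; norm_num [cmFieldDiscrOfJ]
    refine ⟨hCM, ?_, ?_⟩
    · unfold CMRamified; rw [hd]; decide
    · unfold CMSplit; rw [hd, if_neg (by decide)]; rintro ⟨-, r, hr⟩; revert r hr; decide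
  · have hd : cmFieldDiscrOfJ V.j = -11 := by rw [h]; norm_num [cmFieldDiscrOfJ]
    refine ⟨hCM, ?_, ?_⟩
    · unfold CMRamified; rw [hd]; decide
    · unfold CMSplit; rw [hd, if_neg (by decide)]; rintro ⟨-, r, hr⟩; revert r hr; decide
  · have hd : cmFieldDiscrOfJ V.j = -19 := by rw [h]; norm_num [cmFieldDiscrOfJ]
    refine ⟨hCM, ?_, ?_⟩
    · unfold CMRamified; rw [hd]; decide
    · unfold CMSplit; rw [hd, if_neg (by decide)]; rintro ⟨-, r, hr⟩; revert r hr; decide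
  · have hd : cmFieldDiscrOfJ V.j = -67 := by rw [h]; norm_num [cmFieldDiscrOfJ]
    refine ⟨hCM, ?_, ?_⟩
    · unfold CMRamified; rw [hd]; decide
    · unfold CMSplit; rw [hd, if_neg (by decide)]; rintro ⟨-, r, hr⟩; revert r hr; decide
  · have hd : cmFieldDiscrOfJ V.j = -163 := by rw [h]; norm_num [cmFieldDiscrOfJ]
    refine ⟨hCM, ?_, ?_⟩
    · unfold CMRamified; rw [hd]; decide
    · unfold CMSplit; rw [hd, if_neg (by decide)]; rintro ⟨-, r, hr⟩; revert r hr; decide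

/-- **`j ∈ S₁₇ ⟹ CM with `17` inert** (`d_K ∈ {−3, −7, −11, −163}`, non-residues mod `17`).
[cite: SilvermanAdvancedTopics1994, App. A §3] [cite: Cox2013, Prop. 5.16 and Cor. 5.17] -/
theorem hasCM_cmInert_seventeen_of_j_mem (V : WeierstrassCurve ℚ) [V.IsElliptic] (hj : V.j ∈ ({0, 54000, -12288000, -3375, 16581375, -32768, -262537412640768000} : Finset ℚ)) :
    V.HasCM ∧ CMInert V 17 := by
  have hCM : V.HasCM := (hasCM_iff_j_mem_holds V).mpr (by
    simp only [Finset.mem_insert, Finset.mem_singleton] at hj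
    rcases hj with h | h | h | h | h | h | h <;> rw [h] <;> simp [cmJInvariants])
  unfold CMInert
  simp only [Finset.mem_insert, Finset.mem_singleton] at hj
  rcases hj with h | h | h | h | h | h | h
  · have hd : cmFieldDiscrOfJ V.j = -3 := by rw [h]; norm_num [cmFieldDiscrOfJ]
    refine ⟨hCM, ?_, ?_⟩
    · unfold CMRamified; rw [hd]; decide
    · unfold CMSplit; rw [hd, if_neg (by decide)]; rintro ⟨-, r, hr⟩; revert r hr; decide
  · have hd : cmFieldDiscrOfJ V.j = -3 := by rw [h]; norm_num [cmFieldDiscrOfJ]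
    refine ⟨hCM, ?_, ?_⟩
    · unfold CMRamified; rw [hd]; decide
    · unfold CMSplit; rw [hd, if_neg (by decide)]; rintro ⟨-, r, hr⟩; revert r hr; decide
  · have hd : cmFieldDiscrOfJ V.j = -3 := by rw [h]; norm_num [cmFieldDiscrOfJ]
    refine ⟨hCM, ?_, ?_⟩
    · unfold CMRamified; rw [hd]; decide
    · unfold CMSplit; rw [hd, if_neg (by decide)]; rintro ⟨-, r, hr⟩; revert r hr; decide
  · have hd : cmFieldDiscrOfJ V.j = -7 := by rw [h]; norm_num [cmFieldDiscrOfJ]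
    refine ⟨hCM, ?_, ?_⟩
    · unfold CMRamified; rw [hd]; decide
    · unfold CMSplit; rw [hd, if_neg (by decide)]; rintro ⟨-, r, hr⟩; revert r hr; decide
  · have hd : cmFieldDiscrOfJ V.j = -7 := by rw [h]; norm_num [cmFieldDiscrOfJ]
    refine ⟨hCM, ?_, ?_⟩
    · unfold CMRamified; rw [hd]; decide
    · unfold CMSplit; rw [hd, if_neg (by decide)]; rintro ⟨-, r, hr⟩; revert r hr; decide
  · have hd : cmFieldDiscrOfJ V.j = -11 := by rw [h]; norm_num [cmFieldDiscrOfJ]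
    refine ⟨hCM, ?_, ?_⟩
    · unfold CMRamified; rw [hd]; decide
    · unfold CMSplit; rw [hd, if_neg (by decide)]; rintro ⟨-, r, hr⟩; revert r hr; decide
  · have hd : cmFieldDiscrOfJ V.j = -163 := by rw [h]; norm_num [cmFieldDiscrOfJ]
    refine ⟨hCM, ?_, ?_⟩
    · unfold CMRamified; rw [hd]; decide
    · unfold CMSplit; rw [hd, if_neg (by decide)]; rintro ⟨-, r, hr⟩; revert r hr; decide

/-! ## §2 `j ∈ S_p` and good at `p` ⟹ row (Deuring + Zywina, kernel, no named fact) -/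

/-- **Rows at `13` from the `j`-invariant alone (kernel).** `V/ℚ` globally minimal, good at `13`, `j(V) ∈ S₁₃` ⟹ `a_13(V) = 0` (Deuring at the
inert good prime `13`: the tree theorem `Rank1Residual.frobeniusTrace_eq_zero_of_hasCM_of_cmInert`), the `13`-adic tower is not onto (Zywina)
and `V` has CM. [cite: Lang1987, Ch. 13 §4 Thm. 12] [cite: Zywina2015, Prop. 1.14] -/
theorem row_thirteen_of_j_mem (V : WeierstrassCurve ℚ) [V.IsElliptic] [V.IsGloballyMinimal] (p : ℕ) [Fact p.Prime] (hp : p = 13)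
    (hgood : V.HasGoodReductionAtPrime p) (hj : V.j ∈ ({-3375, 16581375, 8000, -32768, -884736, -147197952000, -262537412640768000} : Finset ℚ)) :
    V.frobeniusTrace p = 0 ∧ ¬ (∀ m : ℕ, V.HasSurjectiveModNGaloisRep (p ^ m : ℕ)) ∧ V.HasCM := by
  obtain ⟨hCM, hin⟩ := hasCM_cmInert_thirteen_of_j_mem V hj
  have hin' : CMInert V p := by rw [hp]; exact hin
  have hp2 : p ≠ 2 := by omega
  refine ⟨Summit.BirchSwinnertonDyer.Rank1Residual.frobeniusTrace_eq_zero_of_hasCM_of_cmInert hCM hp2 hgood hin',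
    fun h => ?_, hCM⟩
  exact V.not_hasSurjectiveModNGaloisRep_of_hasCM hCM Fact.out hp2 (by simpa using h 1)

/-- **Rows at `17` from the `j`-invariant alone (kernel).** [cite: Lang1987, Ch. 13 §4 Thm. 12] [cite: Zywina2015, Prop. 1.14] -/
theorem row_seventeen_of_j_mem (V : WeierstrassCurve ℚ) [V.IsElliptic] [V.IsGloballyMinimal] (p : ℕ) [Fact p.Prime] (hp : p = 17)
    (hgood : V.HasGoodReductionAtPrime p) (hj : V.j ∈ ({0, 54000, -12288000, -3375, 16581375, -32768, -262537412640768000} : Finset ℚ)) :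
    V.frobeniusTrace p = 0 ∧ ¬ (∀ m : ℕ, V.HasSurjectiveModNGaloisRep (p ^ m : ℕ)) ∧ V.HasCM := by
  obtain ⟨hCM, hin⟩ := hasCM_cmInert_seventeen_of_j_mem V hj
  have hin' : CMInert V p := by rw [hp]; exact hin
  have hp2 : p ≠ 2 := by omega
  refine ⟨Summit.BirchSwinnertonDyer.Rank1Residual.frobeniusTrace_eq_zero_of_hasCM_of_cmInert hCM hp2 hgood hin',
    fun h => ?_, hCM⟩
  exact V.not_hasSurjectiveModNGaloisRep_of_hasCM hCM Fact.out hp2 (by simpa using h 1)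

/-! ## §3 Rows at `13` / `17` ⟺ `j` in the seven-element set (given BDMTV) -/

/-- **THE ROWS OF CRUX 19606 AT `p = 13`, exactly.** GIVEN BDMTV 2019 Cor. 1.3 (named fact, hypothesis position): for `V/ℚ` globally minimal and
good at `13`, `V` is a row of the crux (`a_13(V) = 0` and the `13`-adic tower is not onto) IFF `j(V) ∈ {−3375, 16581375, 8000, −32768, −884736,
−147197952000, −262537412640768000}` (the seven CM points of `X_ns⁺(13)`, discriminants `−7, −28, −8, −11, −19, −67, −163`). ⟹ `j_mem_seven_of_row_thirteen`;
⟸ §2 (kernel). [cite: BalakrishnanEtAl2019, Cor. 1.3] [cite: Lang1987, Ch. 13 §4 Thm. 12] [cite: Zywina2015, Prop. 1.14] -/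
theorem row_thirteen_iff_j_mem (h13 : BDMTV2019_nonsplitCartan_level13) (V : WeierstrassCurve ℚ) [V.IsElliptic] [V.IsGloballyMinimal]
    (p : ℕ) [Fact p.Prime] (hp : p = 13) (hgood : V.HasGoodReductionAtPrime p) :
    (V.frobeniusTrace p = 0 ∧ ¬ ∀ m : ℕ, V.HasSurjectiveModNGaloisRep (p ^ m : ℕ)) ↔ V.j ∈ ({-3375, 16581375, 8000, -32768, -884736, -147197952000, -262537412640768000} : Finset ℚ) :=
  ⟨fun h => j_mem_seven_of_row_thirteen h13 V p hp hgood h.1 h.2, fun h => let r := row_thirteen_of_j_mem V p hp hgood h; ⟨r.1, r.2.1⟩⟩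

/-- **THE ROWS OF CRUX 19606 AT `p = 17`, exactly.** GIVEN BDMTV 2023 Thm. 1.2: for `V/ℚ` globally minimal and good at `17`, `V` is a row IFF
`j(V) ∈ {0, 54000, −12288000, −3375, 16581375, −32768, −262537412640768000}` (discriminants `−3, −12, −27, −7, −28, −11, −163`).
[cite: BalakrishnanEtAl2023, Thm. 1.2] [cite: Lang1987, Ch. 13 §4 Thm. 12] [cite: Zywina2015, Prop. 1.14] -/
theorem row_seventeen_iff_j_mem (h17 : BDMTV2023_nonsplitCartan_level17) (V : WeierstrassCurve ℚ) [V.IsElliptic] [V.IsGloballyMinimal]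
    (p : ℕ) [Fact p.Prime] (hp : p = 17) (hgood : V.HasGoodReductionAtPrime p) :
    (V.frobeniusTrace p = 0 ∧ ¬ ∀ m : ℕ, V.HasSurjectiveModNGaloisRep (p ^ m : ℕ)) ↔ V.j ∈ ({0, 54000, -12288000, -3375, 16581375, -32768, -262537412640768000} : Finset ℚ) :=
  ⟨fun h => j_mem_seven_of_row_seventeen h17 V p hp hgood h.1 h.2, fun h => let r := row_seventeen_of_j_mem V p hp hgood h; ⟨r.1, r.2.1⟩⟩

/-! ## §4 The crux at the BDMTV primes as seven `j`-classes each -/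

/-- **(C1⁺_η) on the rows at `13` ⟺ (C1⁺_η) on the globally minimal curves good at `13` with `j ∈ S₁₃`** — GIVEN BDMTV 2019; the node
`QuadraticBranchPlusEtaMainConjectureAt V 13` appears in hypothesis / conclusion positions only (nothing asserted). The crux at `13` is the
`η`-main conjecture on seven explicit CM `j`-classes (all their globally minimal models good at `13` = the quadratic twists unramified at `13`).
[cite: BalakrishnanEtAl2019, Cor. 1.3] [cite: Kobayashi2003, §4 Even main conjecture (p. 8)] -/
theorem plusEtaAt_thirteen_iff_jClasses (h13 : BDMTV2019_nonsplitCartan_level13) [Fact (13 : ℕ).Prime] :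
    (∀ (V : WeierstrassCurve ℚ) [V.IsElliptic] [V.IsGloballyMinimal],
        V.HasGoodReductionAtPrime 13 → V.frobeniusTrace 13 = 0 → ¬ (∀ m : ℕ, V.HasSurjectiveModNGaloisRep (13 ^ m : ℕ)) →
        QuadraticBranchPlusEtaMainConjectureAt V 13) ↔
    (∀ (V : WeierstrassCurve ℚ) [V.IsElliptic] [V.IsGloballyMinimal],
        V.HasGoodReductionAtPrime 13 → V.j ∈ ({-3375, 16581375, 8000, -32768, -884736, -147197952000, -262537412640768000} : Finset ℚ) →
        QuadraticBranchPlusEtaMainConjectureAt V 13) := by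
  constructor
  · intro h V _ _ hgood hj
    obtain ⟨hap, hns, -⟩ := row_thirteen_of_j_mem V 13 rfl hgood hj
    exact h V hgood hap hns
  · intro h V _ _ hgood hap hns
    exact h V hgood (j_mem_seven_of_row_thirteen h13 V 13 rfl hgood hap hns)

/-- **(C1⁺_η) on the rows at `17` ⟺ (C1⁺_η) on the globally minimal curves good at `17` with `j ∈ S₁₇`** — GIVEN BDMTV 2023 (the class
`j = 0` includes the sextic twists `y² = x³ + B`). [cite: BalakrishnanEtAl2023, Thm. 1.2] [cite: Kobayashi2003, §4 Even main conjecture (p. 8)] -/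
theorem plusEtaAt_seventeen_iff_jClasses (h17 : BDMTV2023_nonsplitCartan_level17) [Fact (17 : ℕ).Prime] :
    (∀ (V : WeierstrassCurve ℚ) [V.IsElliptic] [V.IsGloballyMinimal],
        V.HasGoodReductionAtPrime 17 → V.frobeniusTrace 17 = 0 → ¬ (∀ m : ℕ, V.HasSurjectiveModNGaloisRep (17 ^ m : ℕ)) →
        QuadraticBranchPlusEtaMainConjectureAt V 17) ↔
    (∀ (V : WeierstrassCurve ℚ) [V.IsElliptic] [V.IsGloballyMinimal],
        V.HasGoodReductionAtPrime 17 → V.j ∈ ({0, 54000, -12288000, -3375, 16581375, -32768, -262537412640768000} : Finset ℚ) →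
        QuadraticBranchPlusEtaMainConjectureAt V 17) := by
  constructor
  · intro h V _ _ hgood hj
    obtain ⟨hap, hns, -⟩ := row_seventeen_of_j_mem V 17 rfl hgood hj
    exact h V hgood hap hns
  · intro h V _ _ hgood hap hns
    exact h V hgood (j_mem_seven_of_row_seventeen h17 V 17 rfl hgood hap hns)

end Summit.BirchSwinnertonDyer.BirchSwinnertonDyer.Theorems.EtaBDMTVPrimes

end
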